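import Summits.Ventures.Crystal3D.Theorems.StickyWulffConstantCoaxialWallLawTailResidueClosingT5
import HarnessLib

/-!
# Stub closer `stub_multiGrainSmallLow` of the registered skeleton 'CoaxialWallLawCertificates' v4 (crux `CoaxialWallLaw`, stmt-Ventures-19481)

HONEST FRAMING. Venture `Summits/Ventures/Crystal3D` (cell `crystal3d-full`); `--supports` the crux `CoaxialWallLaw` (stmt-Ventures-19481,
`route-Ventures-StickyWulffConstant`), registered line 'CoaxialWallLawCertificates' v4 (cf-p1 (clxxxii)/(clxxxvii); eleven stubs, composition
`coaxialWallLaw_of_lensCertificates_split`).  Closes the stub `stub_multiGrainSmallLow : TailResidue.MultiGrainSmallLow (2√6) 3` BY NAME with the tree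
theorem `TailResidue.multiGrainSmallLow_three` (…TailResidueClosingT5 ← …PayerPoolBound: the census-free payer-pool bound `Σ_A(z) ≤ 13·deg z/(12 − deg z)`,
`≤ 13/3 < 2√6` at payers of degree `≤ 3`).  Standard axioms.  Nothing new is proved here.
-/

namespace Summit.Ventures.Crystal3D.Cruxes.CoaxialWallLaw.Certificates

/-- **Stub closer**: `TailResidue.MultiGrainSmallLow (2√6) 3` — low-degree payers are under the line, census-free (tree theorem
`TailResidue.multiGrainSmallLow_three`). -/
theorem stub_multiGrainSmallLow : Summit.Ventures.Crystal3D.Theorems.TailResidue.MultiGrainSmallLow (2 * Real.sqrt 6) 3 :=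
  Summit.Ventures.Crystal3D.Theorems.TailResidue.multiGrainSmallLow_three

end Summit.Ventures.Crystal3D.Cruxes.CoaxialWallLaw.Certificates
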